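import Literature.IUT.HodgeTheaters.ProfiniteCompletionCentralizers
import HarnessLib

/-!
# [IUTchI] §2 tool: the centralizer condition in `F̂` from HEREDITARY CONJUGACY SEPARABILITY

Mochizuki, *Inter-universal Teichmüller theory I*, kurims manuscript (May 2020), §2, proof of
Theorem 2.6, p. 57: "let us recall that `G` is conjugacy separable. Indeed, this is precisely the content
of [Stb1], Theorem 1, when `G` is free; [Stb2], Theorem 3.3, when `G` is an orientable surface group"
[cite: Mochizuki2012, Thm 2.6 p.57] (D-0012 claim key; series status DISPUTED — the content of this file
is classical combinatorial / profinite group theory and takes no side).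

PROOF-ONLY companion of `ProfiniteCompletionCentralizers.lean` (abc-iut-L5-d2, gen 0).  That file derives
the separation hypothesis `hsep` of the centralizer condition from conjugacy separability of FREE groups
(`sep_of_isFreeGroup`, transporting along `K ≃* FreeGroup _`).  Here the same step is done for an
ABSTRACT finite-index subgroup: all that is used about `K = N·⟨g⟩` is that `K` ITSELF is conjugacy
separable (non-conjugate elements of `K` stay non-conjugate in some finite quotient of `K`).  Hence the
centralizer condition `C_{F̂}(η g) = closure (η '' C_F(g))` holds for every element `g` of a finite-index
subgroup `G ⊆ F` that is HEREDITARILY conjugacy separable (every finite-index subgroup of `G` is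
conjugacy separable) — the form in which the orientable-surface-group half of Theorem 2.6 consumes
[Stb2] Thm 3.3 (Fuchsian groups, in particular orientable surface groups and their finite-index
subgroups, are conjugacy separable).  Nothing about surface groups is proved or assumed in this file.

* `sep_of_conjSeparable` — `hsep` at level `N` from conjugacy separability of `K = N·⟨g⟩`;
* `centralizer_toCompletion_eq_closure_of_hcs` — the centralizer condition for `g ∈ G`, `G ⊆ F` of
  finite index and hereditarily conjugacy separable (levels `N ∩ core(G) ⊆ G` are cofinal);
* `mem_closure_centralizer_of_commute_of_hcs` — the same in the membership shape consumed by the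
  Theorem 2.6 (b) argument (`σ * η g = η g * σ ⇒ σ ∈ closure (η '' C_F(g))`);
* `conjSeparable_of_mulEquiv`, `hcs_subgroup_of_hcs` — transport of (hereditary) conjugacy
  separability along isomorphisms / to subgroups of `F` contained in `G`, so that a hypothesis stated
  on an abstract group `G` (e.g. "every finite-index subgroup of an orientable surface group is
  conjugacy separable") feeds the `Subgroup F`-shaped hypotheses used here.
-/

namespace Literature.IUT.HodgeTheaters.ProfiniteCompletion

open CategoryTheory ProfiniteGrp ProfiniteGrp.ProfiniteCompletion Topology Pointwise

universe u

variable {F : Type u} [Group F]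

/-! ### Transport of conjugacy separability -/

/-- Conjugacy separability (finite-quotient form) is invariant under group isomorphism.
[cite: Mochizuki2012, Thm 2.6 p.57] -/
theorem conjSeparable_of_mulEquiv {A : Type*} [Group A] {B : Type*} [Group B] (e : A ≃* B)
    (hB : ∀ u v : B, ¬ IsConj u v →
      ∃ (L : Subgroup B) (_ : L.Normal) (_ : L.FiniteIndex),
        ¬ IsConj (QuotientGroup.mk u : B ⧸ L) (QuotientGroup.mk v)) :
    ∀ u v : A, ¬ IsConj u v →
      ∃ (L : Subgroup A) (_ : L.Normal) (_ : L.FiniteIndex),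
        ¬ IsConj (QuotientGroup.mk u : A ⧸ L) (QuotientGroup.mk v) := by
  intro u v huv
  have huv' : ¬ IsConj (e u) (e v) := fun h => huv (by simpa using e.symm.toMonoidHom.map_isConj h)
  obtain ⟨L, hLn, hLf, hL⟩ := hB (e u) (e v) huv'
  haveI := hLn
  haveI hfi : (L.comap e.toMonoidHom).FiniteIndex := by
    constructor
    rw [Subgroup.index_comap_of_surjective _ e.surjective]
    exact hLf.index_ne_zero
  refine ⟨L.comap e.toMonoidHom, inferInstance, hfi, fun hc => hL ?_⟩
  let q : A ⧸ L.comap e.toMonoidHom →* B ⧸ L := QuotientGroup.map _ L e.toMonoidHom le_rfl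
  have hq := q.map_isConj hc
  exact hq

/-- From hereditary conjugacy separability of an abstract group `G` (every finite-index subgroup of
`G` is conjugacy separable) to the `Subgroup F`-shaped hypothesis used below: every subgroup `K ⊆ F`
of finite index with `K ⊆ G` is conjugacy separable (`K ≅ K ∩ G` as a finite-index subgroup of `G`).
[cite: Mochizuki2012, Thm 2.6 p.57] -/
theorem hcs_subgroup_of_hcs (G : Subgroup F) [G.FiniteIndex]
    (hG : ∀ K : Subgroup G, K.FiniteIndex → ∀ u v : K, ¬ IsConj u v →
      ∃ (L : Subgroup K) (_ : L.Normal) (_ : L.FiniteIndex),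
        ¬ IsConj (QuotientGroup.mk u : K ⧸ L) (QuotientGroup.mk v))
    (K : Subgroup F) (hKG : K ≤ G) [K.FiniteIndex] :
    ∀ u v : K, ¬ IsConj u v →
      ∃ (L : Subgroup K) (_ : L.Normal) (_ : L.FiniteIndex),
        ¬ IsConj (QuotientGroup.mk u : K ⧸ L) (QuotientGroup.mk v) := by
  haveI : (K.subgroupOf G).FiniteIndex := inferInstance
  exact conjSeparable_of_mulEquiv (Subgroup.subgroupOfEquivOfLe hKG).symm (hG (K.subgroupOf G) inferInstance)

/-! ### The separation property from conjugacy separability of `K = N·⟨g⟩` -/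

/-- **Conjugacy separability of `K = N·⟨g⟩` supplies the separation hypothesis** of
`val_eq_mk_of_commute` at level `N`: if the finite-index subgroup `K = N·⟨g⟩` of `F` is conjugacy
separable (as an abstract group, finite-quotient form), then every `g' ∈ K` not `K`-conjugate to `g` is
separated from the `K`-class of `g` in a finite quotient of `F` (push the separating normal subgroup of
`K` into `F` and take its normal core). [cite: Mochizuki2012, Thm 2.6 p.57] -/
theorem sep_of_conjSeparable (g : F) (N : FiniteIndexNormalSubgroup F)
    (hcsK : ∀ u v : ↥(N.toSubgroup ⊔ Subgroup.zpowers g), ¬ IsConj u v →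
      ∃ (L : Subgroup ↥(N.toSubgroup ⊔ Subgroup.zpowers g)) (_ : L.Normal) (_ : L.FiniteIndex),
        ¬ IsConj (QuotientGroup.mk u : _ ⧸ L) (QuotientGroup.mk v)) :
    ∀ g' ∈ N.toSubgroup ⊔ Subgroup.zpowers g,
      (¬ ∃ k ∈ N.toSubgroup ⊔ Subgroup.zpowers g, k * g * k⁻¹ = g') →
      ∃ M : FiniteIndexNormalSubgroup F, ∀ k ∈ N.toSubgroup ⊔ Subgroup.zpowers g,
        (QuotientGroup.mk (k * g * k⁻¹) : F ⧸ M.toSubgroup) ≠ QuotientGroup.mk g' := by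
  intro g' hg' hnc
  set K : Subgroup F := N.toSubgroup ⊔ Subgroup.zpowers g with hK
  haveI : K.FiniteIndex := Subgroup.finiteIndex_of_le (le_sup_left : N.toSubgroup ≤ K)
  have hg : g ∈ K := Subgroup.mem_sup_right (Subgroup.mem_zpowers g)
  set u : K := ⟨g, hg⟩ with hu
  set v : K := ⟨g', hg'⟩ with hv
  have hnc' : ¬ IsConj u v := by
    intro h
    obtain ⟨c, hc⟩ := isConj_iff.mp h
    exact hnc ⟨c, c.2, by simpa [hu, hv, Subtype.ext_iff] using hc⟩
  obtain ⟨K₁, hK₁n, hK₁f, hK₁⟩ := hcsK u v hnc'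
  haveI := hK₁n
  haveI := hK₁f
  -- push forward to `F`, take the normal core
  let M₁ : Subgroup F := K₁.map K.subtype
  haveI hM₁f : M₁.FiniteIndex := by
    constructor
    rw [Subgroup.index_map_subtype]
    exact mul_ne_zero hK₁f.index_ne_zero Subgroup.FiniteIndex.index_ne_zero
  let M : FiniteIndexNormalSubgroup F := FiniteIndexNormalSubgroup.ofSubgroup M₁.normalCore
  refine ⟨M, fun k hk heq => ?_⟩
  -- `(k g k⁻¹)⁻¹ g' ∈ M ⊆ M₁`, i.e. the images of `⟨k⟩ u ⟨k⟩⁻¹` and `v` agree in `K ⧸ K₁`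
  have hmem : (k * g * k⁻¹)⁻¹ * g' ∈ M₁ :=
    Subgroup.normalCore_le M₁ (QuotientGroup.eq.mp heq)
  obtain ⟨y, hy, hyval⟩ := Subgroup.mem_map.mp hmem
  set kK : K := ⟨k, hk⟩ with hkK
  have hy' : y = (kK * u * kK⁻¹)⁻¹ * v := by
    apply Subtype.ext
    simpa [hkK, hu, hv] using hyval
  rw [hy'] at hy
  refine hK₁ (isConj_iff.mpr ⟨QuotientGroup.mk kK, ?_⟩)
  rw [← QuotientGroup.mk_mul, ← QuotientGroup.mk_inv, ← QuotientGroup.mk_mul, QuotientGroup.eq]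
  exact hy

/-! ### The centralizer condition from hereditary conjugacy separability -/

/-- **The centralizer condition for elements of a hereditarily conjugacy separable finite-index
subgroup.**  Let `G ⊆ F` be a subgroup of finite index such that every finite-index subgroup `K ⊆ F`
with `K ⊆ G` is conjugacy separable, and let `g ∈ G`.  Then `C_{F̂}(η g) = closure (η '' C_F(g))`
(the levels `N ∩ core(G)` are cofinal and `(N ∩ core(G))·⟨g⟩ ⊆ G`).  For `G` free this is
`centralizer_toCompletion_eq_closure_of_isFreeGroup`; for `G` an orientable surface group the
hypothesis is [Stb2] Thm 3.3. [cite: Mochizuki2012, Thm 2.6 p.57] -/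
theorem centralizer_toCompletion_eq_closure_of_hcs (G : Subgroup F) [G.FiniteIndex]
    (hHCS : ∀ K : Subgroup F, K ≤ G → K.FiniteIndex → ∀ u v : K, ¬ IsConj u v →
      ∃ (L : Subgroup K) (_ : L.Normal) (_ : L.FiniteIndex),
        ¬ IsConj (QuotientGroup.mk u : K ⧸ L) (QuotientGroup.mk v))
    {g : F} (hg : g ∈ G) :
    (Subgroup.centralizer ({toCompletion F g} : Set (profiniteCompletion F)) : Set _) =
      closure (toCompletion F '' (Subgroup.centralizer ({g} : Set F) : Set F)) := by
  apply centralizer_toCompletion_eq_closure g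
  intro N
  -- the level `N' := N ∩ core(G) ⊆ G`
  let N' : FiniteIndexNormalSubgroup F := N ⊓ FiniteIndexNormalSubgroup.ofSubgroup G.normalCore
  have hN'G : N'.toSubgroup ≤ G := (inf_le_right.trans (Subgroup.normalCore_le G))
  refine ⟨N', inf_le_left, sep_of_conjSeparable g N' ?_⟩
  -- `N'·⟨g⟩ ⊆ G` has finite index in `F`, hence is conjugacy separable by `hHCS`
  have hle : N'.toSubgroup ⊔ Subgroup.zpowers g ≤ G :=
    sup_le hN'G ((Subgroup.zpowers_le).mpr hg)
  haveI : (N'.toSubgroup ⊔ Subgroup.zpowers g).FiniteIndex :=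
    Subgroup.finiteIndex_of_le (le_sup_left : N'.toSubgroup ≤ N'.toSubgroup ⊔ Subgroup.zpowers g)
  exact hHCS _ hle inferInstance

/-- **The centralizer condition, membership shape** (the hypothesis shape of the Theorem 2.6 (b)
argument): for `G ⊆ F` of finite index and hereditarily conjugacy separable, `g ∈ G`, and `σ ∈ F̂`
commuting with `η g`, `σ ∈ closure (η '' C_F(g))`. [cite: Mochizuki2012, Thm 2.6 p.57] -/
theorem mem_closure_centralizer_of_commute_of_hcs (G : Subgroup F) [G.FiniteIndex]
    (hHCS : ∀ K : Subgroup F, K ≤ G → K.FiniteIndex → ∀ u v : K, ¬ IsConj u v →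
      ∃ (L : Subgroup K) (_ : L.Normal) (_ : L.FiniteIndex),
        ¬ IsConj (QuotientGroup.mk u : K ⧸ L) (QuotientGroup.mk v))
    {g : F} (hg : g ∈ G) (σ : profiniteCompletion F)
    (hσ : σ * toCompletion F g = toCompletion F g * σ) :
    σ ∈ closure (toCompletion F '' (Subgroup.centralizer ({g} : Set F) : Set F)) := by
  have hmem : σ ∈ (Subgroup.centralizer ({toCompletion F g} : Set (profiniteCompletion F)) : Set _) := by
    rw [SetLike.mem_coe, Subgroup.mem_centralizer_iff]
    intro y hy
    rw [Set.mem_singleton_iff] at hy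
    rw [hy, hσ]
  rwa [centralizer_toCompletion_eq_closure_of_hcs G hHCS hg] at hmem

/-- Hereditary conjugacy separability passes to finite-index subgroups `G₁ ⊆ G` (trivially, in the
`Subgroup F`-shaped form). [cite: Mochizuki2012, Thm 2.6 p.57] -/
theorem hcs_mono {G G₁ : Subgroup F} (h : G₁ ≤ G)
    (hHCS : ∀ K : Subgroup F, K ≤ G → K.FiniteIndex → ∀ u v : K, ¬ IsConj u v →
      ∃ (L : Subgroup K) (_ : L.Normal) (_ : L.FiniteIndex),
        ¬ IsConj (QuotientGroup.mk u : K ⧸ L) (QuotientGroup.mk v)) :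
    ∀ K : Subgroup F, K ≤ G₁ → K.FiniteIndex → ∀ u v : K, ¬ IsConj u v →
      ∃ (L : Subgroup K) (_ : L.Normal) (_ : L.FiniteIndex),
        ¬ IsConj (QuotientGroup.mk u : K ⧸ L) (QuotientGroup.mk v) :=
  fun K hK hKf => hHCS K (hK.trans h) hKf

/-- A conjugacy separable group in which `1` is the only element conjugate to `1` is residually finite
in the form used by the Theorem 2.6 files: every `x ≠ 1` survives in some finite quotient.
[cite: Mochizuki2012, Thm 2.6 p.56] -/
theorem exists_finiteIndex_normal_not_mem_of_conjSeparable {G : Type*} [Group G]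
    (hCS : ∀ u v : G, ¬ IsConj u v →
      ∃ (L : Subgroup G) (_ : L.Normal) (_ : L.FiniteIndex),
        ¬ IsConj (QuotientGroup.mk u : G ⧸ L) (QuotientGroup.mk v))
    {x : G} (hx : x ≠ 1) :
    ∃ (L : Subgroup G) (_ : L.Normal) (_ : L.FiniteIndex), x ∉ L := by
  have hnc : ¬ IsConj (1 : G) x := fun h => hx (isConj_one_right.mp h)
  obtain ⟨L, hLn, hLf, hL⟩ := hCS 1 x hnc
  refine ⟨L, hLn, hLf, fun hxL => hL ?_⟩
  have : (QuotientGroup.mk x : G ⧸ L) = 1 := (QuotientGroup.eq_one_iff x).mpr hxL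
  rw [this, QuotientGroup.mk_one]

end Literature.IUT.HodgeTheaters.ProfiniteCompletion
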